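import Summits.BirchSwinnertonDyer.BirchSwinnertonDyer.Theorems.Rank1ResidualX11RankOneMinimality
import HarnessLib

/-!
# BSD rank-≤1 residual cell: one more Kraus pattern at `2` — `c₆ = 2⁶·L`, `L ≡ 1 (mod 4)` — and the
# corresponding bounded global-minimality criterion (for the model `134832t1` of the visibility census)

HONEST FRAMING (cell `b2b-bsdres-*`, run/shared/lean/b2b/bsd-rank1-residual/, verbatim): prove what
is provable now; shrink each hard class to its core with data; no claim beyond stated classes; the
cell deletes COMBINATION-shaped residual classes from PUBLISHED theorems only, the CONSTRUCTION-shaped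
remainder is typed; this is not "finishing BSD". Unit `b2b-bsdres-x11c` (gen 6). Theorems only (no
definition, no named fact); a TOOL file, no class statement, no label change.

## What this file does

The kernel certificate `Surj W 3` of `GaloisImage/FrobeniusOrderWitness.lean` is read off the
INTEGRAL MODEL of a globally minimal curve, so each per-pair visibility certificate needs the global
minimality of Cremona's model in the kernel. The bounded Kraus/Silverman criterion of
`Theorems/Rank1ResidualX11RankOneMinimality.lean` (`q¹² ∤ Δ ∨ q⁴ ∤ c₄`, or the patterns F2a
`2⁸ ∤ c₄ ∧ 2⁷ ∣ c₆`, F2b `c₆ = 2⁹L, L ≡ 3 (4)`, F3 `3⁸ ‖ c₆`; variant `₂` with F2c `c₆ = 2¹⁰M`, `M`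
odd) covers 29 of the 30 class representatives of the `p = 3` visibility survivors; the model
`134832t1 = [0, −1, 0, −6203208, 15088082928]` (`ord₂ c₄ = 4`, `ord₂ c₆ = 6`, `ord₂ Δ = 23`,
`c₆/2⁶ ≡ 1 (mod 4)`) needs one more NECESSITY instance of Kraus 1989 Prop. 2 at `2`:

* `isMinimalAt_two_of_c₆_eq_64_mul` — for `W/ℚ` integral at the place `v` of `2` with
  `|Δ|₂ > 2⁻²⁴`, `c₆(W) = 64·L` and `4 ∣ L − 1`: `W` is minimal at `v`. For the only possible
  descent `u = 2w` the descended `c₆' = c₆/(64w⁶) = y = L w⁻⁶` is a unit with `y ≡ 1 (mod 4)`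
  (`w⁻⁶ ≡ 1 (mod 8)`), so `|c₆'| = 1 > 2⁻⁵`, `|c₆' − 8| = 1 > 2⁻⁵` and `|c₆' + 1| = 2⁻¹ > 2⁻²`: all
  of Kraus's alternatives fail (`isMinimal_of_kraus_fails_of_Δ`; an integral equation has
  `c₆ ≡ −b₂³ ≡ 0, −1 (mod 4)`).
* `isGloballyMinimal_of_krausCriterion₃` / `…_bounded₃` — global minimality of `[a₁,…,a₆]` when
  every prime satisfies Silverman's criterion or this pattern (bounded, `decide`-able form:
  `q < 512`, `|Δ| < 512¹²`).

References: A. Kraus, Acta Arith. 54 (1989) Prop. 2 [Kraus1989]; J. E. Cremona, *Algorithms* §3.2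
(Laska–Kraus–Connell) [CremonaAlgorithms1997]; Silverman AEC VII.1 Remark 1.1, III.1 Table 3.1
[SilvermanAEC2009].
-/

set_option autoImplicit false

noncomputable section

open scoped Classical

open IsDedekindDomain NumberField Rat.HeightOneSpectrum WeierstrassCurve
  Literature.NumberTheory.EllipticCurves
  Literature.NumberTheory.EllipticCurves.Rank1Residual.X11RankOneCertificates
  Literature.NumberTheory.GaloisRepresentations
  Summit.BirchSwinnertonDyer.BirchSwinnertonDyer.Rank1Residual.X11RankOne

namespace Summit.BirchSwinnertonDyer.Rank1Residual.X11b

section Two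

variable (v : HeightOneSpectrum (𝓞 ℚ)) (W : WeierstrassCurve ℚ)

/-- **Minimality at `2`, pattern `c₆ = 2⁶L`, `L ≡ 1 (mod 4)`, `ord₂ Δ < 24`.** For `W / ℚ` integral at
the place `v` of `2` with `|Δ|₂ > 2⁻²⁴` and `c₆(W) = 64·L`, `4 ∣ L − 1`: `W` is minimal at `v`. For
the only possible descent `u = 2w` the descended `c₆' = c₆/(64w⁶) = y` with `y = L w⁻⁶` a unit,
`y ≡ 1 (mod 4)` (`w⁻⁶ ≡ 1 (mod 8)`): `|c₆'| = 1 > 2⁻⁵`, `|c₆' − 8| = 1 > 2⁻⁵`, and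
`|c₆' + 1| = |((w⁻⁶ − 1)L + (L − 1)) + 2| = 2⁻¹ > 2⁻²`, so all of Kraus's alternatives fail
(`isMinimal_of_kraus_fails_of_Δ`). Covers the census model `134832t1`. [cite: Kraus1989, Prop. 2]
[cite: CremonaAlgorithms1997, §3.2 (Laska–Kraus–Connell)] -/
theorem isMinimalAt_two_of_c₆_eq_64_mul (hv : natGenerator v = 2) (hint : W.IsIntegralAt v)
    (hΔ : WithZero.exp (-24 : ℤ) < v.valuation ℚ W.Δ) {L : ℤ} (hL : W.c₆ = 64 * L)
    (hL1 : (4 : ℤ) ∣ L - 1) : W.IsMinimalAt v := by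
  set K := v.adicCompletion ℚ with hK
  set Y : WeierstrassCurve K := W.baseChange K with hY
  haveI : Y.IsIntegral (v.adicCompletionIntegers ℚ) := hint
  have V2 := valued_two v hv
  have h20 : (2 : K) ≠ 0 := by
    intro h; rw [h, Valuation.map_zero] at V2; exact WithZero.coe_ne_zero V2.symm
  have V8 : Valued.v (8 : K) = WithZero.exp (-3 : ℤ) := by
    rw [show (8 : K) = 2 ^ 3 by norm_num, Valuation.map_pow, V2, ← WithZero.exp_nsmul]; norm_num
  have hYΔ : WithZero.exp (-24 : ℤ) < Valued.v Y.Δ := by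
    rw [hY, WeierstrassCurve.baseChange, map_Δ, WeierstrassCurve.valued_algebraMap_adicCompletion]; exact hΔ
  have hYc6 : Y.c₆ = 64 * algebraMap ℚ K L := by
    rw [hY, WeierstrassCurve.baseChange, map_c₆, hL, map_mul]; norm_num
  -- the integer `L`: odd, `≡ 1 (mod 4)`
  have hLodd : ¬ (2 : ℤ) ∣ L := fun h ↦ by
    have h4 : (2 : ℤ) ∣ L - 1 := dvd_trans ⟨2, by norm_num⟩ hL1
    have : (2 : ℤ) ∣ 1 := by simpa using dvd_sub h h4
    norm_num at this
  set l : K := algebraMap ℚ K L with hl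
  have hVl : Valued.v l = 1 := valued_intCast_eq_one_of_odd v hv hLodd
  have hVl1 : Valued.v (l - 1) ≤ WithZero.exp (-2 : ℤ) := by
    have := valued_intCast_le_of_dvd v hv (n := L - 1) (e := 2) (by simpa using hL1)
    rwa [Int.cast_sub, map_sub, Int.cast_one, map_one] at this
  refine isMinimal_of_kraus_fails_of_Δ v hv Y hYΔ fun w hw H ↦ ?_
  have hw0 : w ≠ 0 := by
    intro h; rw [h, Valuation.map_zero] at hw; exact zero_ne_one hw
  have hwi : Valued.v w⁻¹ = 1 := by rw [map_inv₀, hw, inv_one]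
  set y : K := w⁻¹ ^ 6 * l with hy
  have hunit : Valued.v y = 1 := by
    rw [hy, Valuation.map_mul, Valuation.map_pow, hwi, one_pow, one_mul, hVl]
  have h64 : (64 : K) ≠ 0 := by
    rw [show (64 : K) = 2 ^ 6 by norm_num]; exact pow_ne_zero _ h20
  have he : Y.c₆ / (64 * w ^ 6) = y := by
    rw [hYc6, hy, div_eq_iff (mul_ne_zero h64 (pow_ne_zero 6 hw0)), inv_pow,
      show (w ^ 6)⁻¹ * l * (64 * w ^ 6) = 64 * l * ((w ^ 6)⁻¹ * w ^ 6) by ring,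
      inv_mul_cancel₀ (pow_ne_zero 6 hw0), mul_one]
  rw [he] at H
  rcases H with ⟨-, h | h⟩ | h
  · rw [hunit, ← WithZero.exp_zero, WithZero.exp_le_exp] at h
    norm_num at h
  · -- `|y - 8| = |y| = 1`
    have hlt : Valued.v (-8 : K) < Valued.v y := by
      rw [Valuation.map_neg, V8, hunit, ← WithZero.exp_zero, WithZero.exp_lt_exp]; norm_num
    have : Valued.v (y - 8) = 1 := by
      rw [sub_eq_add_neg, Valuation.map_add_eq_of_lt_left _ hlt, hunit]
    rw [this, ← WithZero.exp_zero, WithZero.exp_le_exp] at h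
    norm_num at h
  · -- `y + 1 = ((w⁻⁶ - 1)L + (L - 1)) + 2` has valuation `exp(-1)`
    have h6 := valued_pow_six_sub_one_le v hv hwi
    have hsmall : Valued.v ((w⁻¹ ^ 6 - 1) * l + (l - 1)) ≤ WithZero.exp (-2 : ℤ) := by
      refine Valuation.map_add_le _ ?_ hVl1
      rw [Valuation.map_mul, hVl, mul_one]
      exact h6.trans (by rw [WithZero.exp_le_exp]; norm_num)
    have hlt2 : Valued.v ((w⁻¹ ^ 6 - 1) * l + (l - 1)) < Valued.v (2 : K) := by
      rw [V2]; exact lt_of_le_of_lt hsmall (by rw [WithZero.exp_lt_exp]; norm_num)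
    have hy1 : Valued.v (y + 1) = WithZero.exp (-1 : ℤ) := by
      have : y + 1 = ((w⁻¹ ^ 6 - 1) * l + (l - 1)) + 2 := by rw [hy]; ring
      rw [this, Valuation.map_add_eq_of_lt_right _ hlt2, V2]
    rw [hy1, WithZero.exp_le_exp] at h
    norm_num at h

end Two

/-! ### Global minimality: Silverman's criterion or the pattern `c₆ = 2⁶L`, `L ≡ 1 (mod 4)` -/

/-- **An integer Weierstrass model is globally minimal when every prime `q` satisfies Silverman's
criterion (`q¹² ∤ Δ` or `q⁴ ∤ c₄`, AEC VII.1 Remark 1.1) or, at `q = 2`, the Kraus pattern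
`2²⁴ ∤ Δ ∧ c₆ = 2⁶L, L ≡ 1 (mod 4)` (`isMinimalAt_two_of_c₆_eq_64_mul`).** `Δ`, `c₄`, `c₆` are the
tree-rechecked integers `discOf`/`c4Of`/`c6Of` of `Schema.lean`.
[cite: SilvermanAEC2009, VII.1 Remark 1.1 and VIII.8] [cite: Kraus1989, Prop. 2] -/
theorem isGloballyMinimal_of_krausCriterion₃ (a1 a2 a3 a4 a6 : ℤ)
    (h : ∀ q : ℕ, q.Prime →
      (¬ (q : ℤ) ^ 12 ∣ discOf [a1, a2, a3, a4, a6] ∨ ¬ (q : ℤ) ^ 4 ∣ c4Of [a1, a2, a3, a4, a6]) ∨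
      (q = 2 ∧ ¬ (2 : ℤ) ^ 24 ∣ discOf [a1, a2, a3, a4, a6] ∧
        ∃ L : ℤ, c6Of [a1, a2, a3, a4, a6] = 64 * L ∧ (4 : ℤ) ∣ L - 1)) :
    (⟨a1, a2, a3, a4, a6⟩ : WeierstrassCurve ℚ).IsGloballyMinimal where
  isIntegral := isIntegral_of_exists_lift (𝓞 ℚ) ⟨(a1 : 𝓞 ℚ), by simp⟩ ⟨(a2 : 𝓞 ℚ), by simp⟩
    ⟨(a3 : 𝓞 ℚ), by simp⟩ ⟨(a4 : 𝓞 ℚ), by simp⟩ ⟨(a6 : 𝓞 ℚ), by simp⟩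
  isMinimal v := by
    set W : WeierstrassCurve ℚ := ⟨a1, a2, a3, a4, a6⟩ with hW
    have hle : ∀ m : ℤ, v.valuation ℚ (m : ℚ) ≤ 1 := fun m ↦ by
      have hm : (m : ℚ) = algebraMap (𝓞 ℚ) ℚ (m : 𝓞 ℚ) := by simp
      rw [hm]
      exact v.valuation_le_one _
    have hint : W.IsIntegralAt v :=
      W.isIntegralAt_of_valuation_le_one v (hle a1) (hle a2) (hle a3) (hle a4) (hle a6)
    have hΔ : W.Δ = ((discOf [a1, a2, a3, a4, a6] : ℤ) : ℚ) := by
      simp only [hW, WeierstrassCurve.Δ, WeierstrassCurve.b₂, WeierstrassCurve.b₄, WeierstrassCurve.b₆,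
        WeierstrassCurve.b₈, discOf, invariants]
      push_cast
      ring
    have hc4 : W.c₄ = ((c4Of [a1, a2, a3, a4, a6] : ℤ) : ℚ) := by
      simp only [hW, WeierstrassCurve.c₄, WeierstrassCurve.b₂, WeierstrassCurve.b₄, c4Of, invariants]
      push_cast
      ring
    have hc6 : W.c₆ = ((c6Of [a1, a2, a3, a4, a6] : ℤ) : ℚ) := by
      simp only [hW, WeierstrassCurve.c₆, WeierstrassCurve.b₂, WeierstrassCurve.b₄, WeierstrassCurve.b₆,
        c6Of, invariants]
      push_cast
      ring
    rcases h _ (prime_natGenerator v) with (h12 | h4) | ⟨h2, h24, L, hL, hL1⟩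
    · exact isMinimalAt_of_lt_valuation_Δ_holds hint
        (by rw [hΔ]; exact exp_neg_lt_valuation_intCast_of_not_pow_dvd v h12)
    · exact isMinimalAt_of_lt_valuation_c₄ hint
        (by rw [hc4]; exact exp_neg_lt_valuation_intCast_of_not_pow_dvd v h4)
    · refine isMinimalAt_two_of_c₆_eq_64_mul v W h2 hint ?_ (L := L) (by rw [hc6, hL]; push_cast; ring)
        hL1
      rw [hΔ]
      exact_mod_cast exp_neg_lt_valuation_intCast_of_not_pow_dvd v (e := 24) (by rw [h2]; exact_mod_cast h24)

/-- **Bounded form** (the shape `decide` evaluates): `Δ ≠ 0`, `|Δ| < 512¹²`, and for every `q < 512`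
the disjunction "`q < 2`, or `q¹² ∤ |Δ|`, or `q⁴ ∤ |c₄|`, or (`q = 2`, `2²⁴ ∤ Δ`, `64 ∣ c₆`,
`4 ∣ c₆/64 − 1`)"; primes `q ≥ 512` have `q¹² > |Δ|`. [cite: SilvermanAEC2009, VII.1 Remark 1.1]
[cite: Kraus1989, Prop. 2] -/
theorem isGloballyMinimal_of_krausCriterion_bounded₃ (a1 a2 a3 a4 a6 : ℤ)
    (h0 : discOf [a1, a2, a3, a4, a6] ≠ 0) (hB : (discOf [a1, a2, a3, a4, a6]).natAbs < 512 ^ 12)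
    (h : ∀ q < 512, q < 2 ∨ ¬ q ^ 12 ∣ (discOf [a1, a2, a3, a4, a6]).natAbs ∨
      ¬ q ^ 4 ∣ (c4Of [a1, a2, a3, a4, a6]).natAbs ∨
      (q = 2 ∧ ¬ (2 : ℤ) ^ 24 ∣ discOf [a1, a2, a3, a4, a6] ∧ (64 : ℤ) ∣ c6Of [a1, a2, a3, a4, a6] ∧
        (4 : ℤ) ∣ c6Of [a1, a2, a3, a4, a6] / 64 - 1)) :
    (⟨a1, a2, a3, a4, a6⟩ : WeierstrassCurve ℚ).IsGloballyMinimal := by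
  refine isGloballyMinimal_of_krausCriterion₃ a1 a2 a3 a4 a6 fun q hq ↦ ?_
  have hpos : 0 < (discOf [a1, a2, a3, a4, a6]).natAbs := Int.natAbs_pos.mpr h0
  by_cases hqB : q < 512
  · rcases h q hqB with hlt | h12 | h4 | ⟨h2, h24, h64, h41⟩
    · exact absurd hq.two_le (by omega)
    · refine Or.inl (Or.inl fun h12' ↦ h12 ?_)
      rw [← Int.natCast_dvd]; exact_mod_cast h12'
    · refine Or.inl (Or.inr fun h4' ↦ h4 ?_)
      rw [← Int.natCast_dvd]; exact_mod_cast h4'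
    · refine Or.inr ⟨h2, h24, c6Of [a1, a2, a3, a4, a6] / 64, ?_, h41⟩
      exact (Int.mul_ediv_cancel' h64).symm
  · refine Or.inl (Or.inl fun h12 ↦ ?_)
    have h12' : q ^ 12 ∣ (discOf [a1, a2, a3, a4, a6]).natAbs := by
      rw [← Int.natCast_dvd]; exact_mod_cast h12
    have hle : q ^ 12 ≤ (discOf [a1, a2, a3, a4, a6]).natAbs := Nat.le_of_dvd hpos h12'
    have hge : 512 ^ 12 ≤ q ^ 12 := Nat.pow_le_pow_left (by omega) 12
    omega

/-- **The census model `134832t1 = [0, −1, 0, −6203208, 15088082928]` is globally minimal**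
(`ord₂ (c₄, c₆, Δ) = (4, 6, 23)`, `c₆/64 ≡ 1 (mod 4)`; `53`: `ord₅₃ c₄ = 0`; kernel-decided).
[cite: Kraus1989, Prop. 2] [cite: Cremona2006, Table 1 (label 134832t1)] -/
theorem isGloballyMinimal_v134832t1 :
    (⟨0, -1, 0, -6203208, 15088082928⟩ : WeierstrassCurve ℚ).IsGloballyMinimal :=
  isGloballyMinimal_of_krausCriterion_bounded₃ 0 (-1) 0 (-6203208) 15088082928
    (by decide +kernel) (by decide +kernel) (by decide +kernel)

end Summit.BirchSwinnertonDyer.Rank1Residual.X11b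

end
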